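import Summits.HubbardSuperconductivity.HubbardSuperconductivity.Theorems.AnisotropyChordTransferFibre3OneLoopKit

/-!
# Route `AnisotropyChord` / H0 rotor rung: PartN33 Layer B — `PiC0OneLoop` and `BCOneLoop` PROVED

Theory seat `hubbard-h0-rotor-theory-1` g21, memo ROTOR-THEORY-21 §297/§299, typed targets `PiC0OneLoop`, `BCOneLoop`
(`…Fibre3KT1Targets`, PORT PartN33), on top of `c0Explicit_holds` (`…Fibre3C0Layer`) and the one-loop toolkit
(`…Fibre3OneLoopKit`).  With `h_e = f·D_e f`, `g = f²`, `φ̂_e = FT[h_e]`, `F₂ = FT[g]`: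
* `cross_sum_w`: for a pair weight `ω` with the two `S₃`-type invariances, the three product-rule pieces of
  `Σ_c ω Π⁰ C0` all reduce (reindexing + evenness of `f`) to ONE canonical triple `Σ_{x,y} ω(x,y) h(x)h(y)g(y−x)`;
* `T1_fourier` (`ω = 1`): the canonical triple is `(1/V)Σ_k |φ̂_e(k)|² F₂(k)` ⇒ **`piC0OneLoop_holds`**;
* `P1_real`, `P3_real`, `Q_fourier` (`ω = κ = Re φ(x) + Re φ(y) + Re φ(y−x)`): modulation by `cos(K₁·)` shifts momenta
  by `±K₁` (`dft_cosmod`), the reflection `k ↦ −k` and the shift `k ↦ k + K₁` collect the pieces into `J_e` ⇒ **`bcOneLoop_holds`**.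
Prover seat `hubbard-h0-rotor-p1` g23; helper for stmt-HubbardSuperconductivity-19089 (`--supports`).
-/

set_option linter.dupNamespace false
set_option autoImplicit false

noncomputable section

open scoped BigOperators
open Complex

namespace Summit.HubbardSuperconductivity.HubbardSuperconductivity.Theorems.AnisotropyChord.Transfer.Fibre3

variable (L : ℕ) [NeZero L]

/-- the three product-rule pieces of the explicit cross term `C0` (the summand of `C0Explicit`, without the `−½`). [folklore] -/
def crossT (f : Tor L → ℝ) (e : Tor L) (c : Cfg L) : ℝ :=
  f (c.2 - c.1) * Dgrad L f e c.1 * Dgrad L f e c.2 + f c.2 * Dgrad L f (-e) c.1 * Dgrad L f e (c.2 - c.1)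
    + f c.1 * Dgrad L f e c.2 * Dgrad L f e (c.2 - c.1)

/-- `Π⁰·C0 = −½ Π⁰·Σ_e crossT` pointwise (explicit form off `D`, both sides vanish on `D`). [folklore] -/
theorem piR_mul_C0fn {Δ lam2 : ℝ} {f : Tor L → ℝ} (hf : IsTwoMagnon L Δ lam2 f) (c : Cfg L) :
    piR L f c * C0fn L Δ lam2 f c = -(1 / 2) * (piR L f c * ((nnList L).map (fun e => crossT L f e c)).sum) := by
  by_cases hc : InD L c = true
  · rw [piR_D L hf.1 c hc]; ring
  · have hc' : InD L c = false := by simpa using hc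
    rw [c0Explicit_holds L Δ lam2 f hf c hc']
    unfold crossT
    ring

omit [NeZero L] in
/-- evenness moves the reversed gradient: `f(−a)·D_e f(−a) = f(a)·D_{−e} f(a)`. [folklore] -/
theorem hfun_neg {f : Tor L → ℝ} (hev : ∀ r : Tor L, f (-r) = f r) (e a : Tor L) :
    f (-a) * Dgrad L f e (-a) = f a * Dgrad L f (-e) a := by
  unfold Dgrad
  rw [hev, show -a - e = -(a + e) by abel, hev, sub_neg_eq_add]

/-- **the three pieces are one canonical triple:** for a pair weight `ω` invariant under `(x,y) ↦ (y−x,y)` and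
`(x,y) ↦ (−x,y−x)` and an even `f`,
`Σ_c ω(c) Π⁰(c) crossT_e(c) = 3 Σ_{x,y} ω(x,y) h_e(x) h_e(y) g(y−x)`. [folklore] -/
theorem cross_sum_w (ω : Tor L → Tor L → ℝ) (hω1 : ∀ x y : Tor L, ω (y - x) y = ω x y)
    (hω2 : ∀ x y : Tor L, ω (-x) (y - x) = ω x y) {f : Tor L → ℝ} (hev : ∀ r : Tor L, f (-r) = f r) (e : Tor L) :
    ∑ c : Cfg L, ω c.1 c.2 * piR L f c * crossT L f e c
      = 3 * ∑ x : Tor L, ∑ y : Tor L, ω x y * (f x * Dgrad L f e x) * (f y * Dgrad L f e y) * f (y - x) ^ 2 := by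
  rw [Fintype.sum_prod_type]
  simp only [piR, crossT]
  have split : ∀ a b : Tor L,
      ω a b * (f a * f b * f (b - a))
        * (f (b - a) * Dgrad L f e a * Dgrad L f e b + f b * Dgrad L f (-e) a * Dgrad L f e (b - a)
            + f a * Dgrad L f e b * Dgrad L f e (b - a))
      = ω a b * (f a * Dgrad L f e a) * (f b * Dgrad L f e b) * f (b - a) ^ 2
        + ω a b * (f a * Dgrad L f (-e) a) * (f b ^ 2) * (f (b - a) * Dgrad L f e (b - a))
        + ω a b * (f (b - a) * Dgrad L f e (b - a)) * (f a ^ 2) * (f b * Dgrad L f e b) := by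
    intro a b; ring
  simp_rw [split, Finset.sum_add_distrib]
  -- piece 2: `a = −x`, `b = y − x`
  have h2 : ∑ a : Tor L, ∑ b : Tor L, ω a b * (f a * Dgrad L f (-e) a) * (f b ^ 2) * (f (b - a) * Dgrad L f e (b - a))
      = ∑ x : Tor L, ∑ y : Tor L, ω x y * (f x * Dgrad L f e x) * (f y * Dgrad L f e y) * f (y - x) ^ 2 := by
    have step : ∑ a : Tor L, ∑ b : Tor L, ω a b * (f a * Dgrad L f (-e) a) * (f b ^ 2) * (f (b - a) * Dgrad L f e (b - a))
        = ∑ a : Tor L, ∑ b : Tor L,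
            ω a b * (fun r => f r * Dgrad L f e r) (-a) * (fun r => f r ^ 2) b
              * (fun r => f r * Dgrad L f e r) (b - a) := by
      refine Finset.sum_congr rfl fun a _ => Finset.sum_congr rfl fun b _ => ?_
      simp only [hfun_neg L hev]
    rw [step, reindex_neg_shift_w L ω (fun r => f r * Dgrad L f e r) (fun r => f r ^ 2) (fun r => f r * Dgrad L f e r)]
    refine Finset.sum_congr rfl fun x _ => Finset.sum_congr rfl fun y _ => ?_
    rw [hω2]; ring
  -- piece 3: `a = y − x`
  have h3 : ∑ a : Tor L, ∑ b : Tor L, ω a b * (f (b - a) * Dgrad L f e (b - a)) * (f a ^ 2) * (f b * Dgrad L f e b)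
      = ∑ x : Tor L, ∑ y : Tor L, ω x y * (f x * Dgrad L f e x) * (f y * Dgrad L f e y) * f (y - x) ^ 2 := by
    rw [reindex_diff_w L ω (fun r => f r * Dgrad L f e r) (fun r => f r ^ 2) (fun r => f r * Dgrad L f e r)]
    refine Finset.sum_congr rfl fun x _ => Finset.sum_congr rfl fun y _ => ?_
    rw [hω1]; ring
  rw [h2, h3]
  ring

omit [NeZero L] in
/-- `V` as a real cast inside `ℂ`. [folklore] -/
theorem Vsq_cast : ((L : ℂ) ^ 2) = (((L : ℝ) ^ 2 : ℝ) : ℂ) := by push_cast; ring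

/-- `FT[f²]` is the real number `F₂` for even `f`. [folklore] -/
theorem dft_sq_eq_F2 {f : Tor L → ℝ} (hev : ∀ r : Tor L, f (-r) = f r) (k : Tor L) :
    dft L (fun r => f r ^ 2) k = ((F2 L f k : ℝ) : ℂ) := by
  have hgev : ∀ r : Tor L, (fun r => f r ^ 2) (-r) = (fun r => f r ^ 2) r := by intro r; simp only [hev]
  rw [dft_even_eq_re L hgev]; rfl

/-! ## `PiC0OneLoop` -/

/-- the canonical triple in Fourier space: `Σ_{x,y} h(x)h(y)g(y−x) = (1/V)Σ_k |φ̂_e(k)|² F₂(k)`. [folklore] -/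
theorem T1_fourier {f : Tor L → ℝ} (hev : ∀ r : Tor L, f (-r) = f r) (e : Tor L) :
    ∑ x : Tor L, ∑ y : Tor L, (1 : ℝ) * (f x * Dgrad L f e x) * (f y * Dgrad L f e y) * f (y - x) ^ 2
      = (∑ k : Tor L, Complex.normSq (phiHat L f e k) * F2 L f k) / (L : ℝ) ^ 2 := by
  have hc := triple_corr2 L (fun r => f r * Dgrad L f e r) (fun r => f r * Dgrad L f e r) (fun r => f r ^ 2)
  have hk : ∀ k : Tor L, (starRingEnd ℂ) (dft L (fun r => f r * Dgrad L f e r) k) * dft L (fun r => f r * Dgrad L f e r) k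
        * (starRingEnd ℂ) (dft L (fun r => f r ^ 2) k)
      = ((Complex.normSq (phiHat L f e k) * F2 L f k : ℝ) : ℂ) := by
    intro k
    rw [dft_sq_eq_F2 L hev, Complex.conj_ofReal]
    unfold phiHat
    push_cast
    rw [Complex.normSq_eq_conj_mul_self]
  rw [Finset.sum_congr rfl fun k _ => hk k, Vsq_cast, ← Complex.ofReal_sum, ← Complex.ofReal_div] at hc
  have := Complex.ofReal_injective hc
  rw [← this]
  refine Finset.sum_congr rfl fun x _ => Finset.sum_congr rfl fun y _ => ?_
  ring

/-- ★ **`PiC0OneLoop L Δ` holds:** `⟨Π⁰, C0⟩ = −(3/2) Σ_e (1/V) Σ_k |φ̂_e(k)|² F₂(k)`. [folklore] -/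
theorem piC0OneLoop_holds (Δ : ℝ) : PiC0OneLoop L Δ := by
  intro lam2 f hf hev
  have key : ∀ e : Tor L, ∑ c : Cfg L, piR L f c * crossT L f e c
      = 3 * ((∑ k : Tor L, Complex.normSq (phiHat L f e k) * F2 L f k) / (L : ℝ) ^ 2) := by
    intro e
    rw [← T1_fourier L hev e, ← cross_sum_w L (fun _ _ => (1 : ℝ)) (fun _ _ => rfl) (fun _ _ => rfl) hev e]
    refine Finset.sum_congr rfl fun c _ => ?_
    ring
  rw [Finset.sum_congr rfl (fun c _ => piR_mul_C0fn L hf c)]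
  simp_rw [nnList_map_sum]
  have hs : ∑ c : Cfg L, -(1 / 2) * (piR L f c * (crossT L f (ex L) c + crossT L f (-ex L) c + crossT L f (ey L) c
      + crossT L f (-ey L) c))
      = -(1 / 2) * (∑ c : Cfg L, piR L f c * crossT L f (ex L) c + ∑ c : Cfg L, piR L f c * crossT L f (-ex L) c
          + ∑ c : Cfg L, piR L f c * crossT L f (ey L) c + ∑ c : Cfg L, piR L f c * crossT L f (-ey L) c) := by
    rw [← Finset.sum_add_distrib, ← Finset.sum_add_distrib, ← Finset.sum_add_distrib, ← Finset.mul_sum]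
    congr 1
    refine Finset.sum_congr rfl fun c _ => ?_
    ring
  rw [hs, key, key, key, key]
  ring

/-! ## `BCOneLoop` -/

/-- `Re(conj z · w) = Re(conj w · z)`. [folklore] -/
theorem re_conj_mul_comm (z w : ℂ) : ((starRingEnd ℂ) z * w).re = ((starRingEnd ℂ) w * z).re := by
  simp only [Complex.mul_re, Complex.conj_re, Complex.conj_im]; ring

/-- the modulated triple `P3 = Σ_{x,y} h(x)h(y)·Re φ(y−x) g(y−x)` in Fourier space:
`P3 = (1/V)Σ_k |φ̂_e(k)|² F₂(k + K₁)`. [folklore] -/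
theorem P3_real {f : Tor L → ℝ} (hev : ∀ r : Tor L, f (-r) = f r) (e : Tor L) :
    ∑ x : Tor L, ∑ y : Tor L, (f x * Dgrad L f e x) * (f y * Dgrad L f e y) * ((phase L (K1 L) (y - x)).re * f (y - x) ^ 2)
      = (∑ k : Tor L, Complex.normSq (phiHat L f e k) * F2 L f (k + K1 L)) / (L : ℝ) ^ 2 := by
  have hc := triple_corr2 L (fun r => f r * Dgrad L f e r) (fun r => f r * Dgrad L f e r)
    (fun r => (phase L (K1 L) r).re * f r ^ 2)
  have hmod : ∀ k : Tor L, dft L (fun r => (phase L (K1 L) r).re * f r ^ 2) k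
      = (((F2 L f (k - K1 L) + F2 L f (k + K1 L)) / 2 : ℝ) : ℂ) := by
    intro k
    rw [show (fun r => (phase L (K1 L) r).re * f r ^ 2) = (fun r => (phase L (K1 L) r).re * (fun r => f r ^ 2) r)
      from rfl, dft_cosmod, dft_sq_eq_F2 L hev, dft_sq_eq_F2 L hev]
    push_cast; ring
  have hk : ∀ k : Tor L, (starRingEnd ℂ) (dft L (fun r => f r * Dgrad L f e r) k) * dft L (fun r => f r * Dgrad L f e r) k
        * (starRingEnd ℂ) (dft L (fun r => (phase L (K1 L) r).re * f r ^ 2) k)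
      = ((Complex.normSq (phiHat L f e k) * ((F2 L f (k - K1 L) + F2 L f (k + K1 L)) / 2) : ℝ) : ℂ) := by
    intro k
    rw [hmod, Complex.conj_ofReal]
    unfold phiHat
    push_cast
    rw [Complex.normSq_eq_conj_mul_self]
  rw [Finset.sum_congr rfl fun k _ => hk k, Vsq_cast, ← Complex.ofReal_sum, ← Complex.ofReal_div] at hc
  have hc' := Complex.ofReal_injective hc
  have lhs : ∑ x : Tor L, ∑ y : Tor L, (f x * Dgrad L f e x) * (f y * Dgrad L f e y) * ((phase L (K1 L) (y - x)).re * f (y - x) ^ 2)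
      = ∑ a : Tor L, ∑ b : Tor L, (fun r => f r * Dgrad L f e r) a * (fun r => f r * Dgrad L f e r) b
          * (fun r => (phase L (K1 L) r).re * f r ^ 2) (b - a) := by
    rfl
  rw [lhs, hc']
  congr 1
  -- reflection `k ↦ −k` on the first half
  have hsym : ∑ k : Tor L, Complex.normSq (phiHat L f e k) * F2 L f (k - K1 L)
      = ∑ k : Tor L, Complex.normSq (phiHat L f e k) * F2 L f (k + K1 L) := by
    rw [← Equiv.sum_comp (Equiv.neg (Tor L)) (fun k => Complex.normSq (phiHat L f e k) * F2 L f (k - K1 L))]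
    refine Finset.sum_congr rfl fun k _ => ?_
    simp only [Equiv.neg_apply]
    unfold phiHat
    rw [normSq_dft_neg, show -k - K1 L = -(k + K1 L) by abel, F2_neg]
  have : ∑ k : Tor L, Complex.normSq (phiHat L f e k) * ((F2 L f (k - K1 L) + F2 L f (k + K1 L)) / 2)
      = (∑ k : Tor L, Complex.normSq (phiHat L f e k) * F2 L f (k - K1 L)
          + ∑ k : Tor L, Complex.normSq (phiHat L f e k) * F2 L f (k + K1 L)) / 2 := by
    rw [← Finset.sum_add_distrib, Finset.sum_div]
    refine Finset.sum_congr rfl fun k _ => ?_; ring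
  rw [this, hsym]
  ring

/-- the modulated triple `P1 = Σ_{x,y} Re φ(x) h(x)·h(y) g(y−x)` in Fourier space:
`2·P1 = (1/V)Σ_k [Re(conj φ̂(k−K₁) φ̂(k)) + Re(conj φ̂(k+K₁) φ̂(k))] F₂(k)`. [folklore] -/
theorem P1_real {f : Tor L → ℝ} (hev : ∀ r : Tor L, f (-r) = f r) (e : Tor L) :
    2 * ∑ x : Tor L, ∑ y : Tor L, ((phase L (K1 L) x).re * (f x * Dgrad L f e x)) * (f y * Dgrad L f e y) * f (y - x) ^ 2
      = (∑ k : Tor L, (((starRingEnd ℂ) (phiHat L f e (k - K1 L)) * phiHat L f e k).re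
          + ((starRingEnd ℂ) (phiHat L f e (k + K1 L)) * phiHat L f e k).re) * F2 L f k) / (L : ℝ) ^ 2 := by
  have hc := triple_corr2 L (fun r => (phase L (K1 L) r).re * (f r * Dgrad L f e r)) (fun r => f r * Dgrad L f e r)
    (fun r => f r ^ 2)
  have hmod : ∀ k : Tor L, dft L (fun r => (phase L (K1 L) r).re * (f r * Dgrad L f e r)) k
      = (phiHat L f e (k - K1 L) + phiHat L f e (k + K1 L)) / 2 := by
    intro k
    rw [show (fun r => (phase L (K1 L) r).re * (f r * Dgrad L f e r))
      = (fun r => (phase L (K1 L) r).re * (fun r => f r * Dgrad L f e r) r) from rfl, dft_cosmod]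
    rfl
  have hk : ∀ k : Tor L, 2 * ((starRingEnd ℂ) (dft L (fun r => (phase L (K1 L) r).re * (f r * Dgrad L f e r)) k)
        * dft L (fun r => f r * Dgrad L f e r) k * (starRingEnd ℂ) (dft L (fun r => f r ^ 2) k))
      = ((starRingEnd ℂ) (phiHat L f e (k - K1 L)) + (starRingEnd ℂ) (phiHat L f e (k + K1 L)))
          * phiHat L f e k * ((F2 L f k : ℝ) : ℂ) := by
    intro k
    rw [hmod, dft_sq_eq_F2 L hev, Complex.conj_ofReal, map_div₀, map_add, map_ofNat]
    unfold phiHat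
    ring
  have h2 : ((2 * ∑ x : Tor L, ∑ y : Tor L,
        ((phase L (K1 L) x).re * (f x * Dgrad L f e x)) * (f y * Dgrad L f e y) * f (y - x) ^ 2 : ℝ) : ℂ)
      = (∑ k : Tor L, ((starRingEnd ℂ) (phiHat L f e (k - K1 L)) + (starRingEnd ℂ) (phiHat L f e (k + K1 L)))
          * phiHat L f e k * ((F2 L f k : ℝ) : ℂ)) / ((L : ℂ) ^ 2) := by
    push_cast
    have hc2 : ((∑ a : Tor L, ∑ b : Tor L, (fun r => (phase L (K1 L) r).re * (f r * Dgrad L f e r)) a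
        * (fun r => f r * Dgrad L f e r) b * (fun r => f r ^ 2) (b - a) : ℝ) : ℂ)
        = ∑ x : Tor L, ∑ y : Tor L,
          (((phase L (K1 L) x).re : ℂ) * ((f x : ℂ) * (Dgrad L f e x : ℂ))) * ((f y : ℂ) * (Dgrad L f e y : ℂ))
            * (f (y - x) : ℂ) ^ 2 := by
      push_cast; rfl
    rw [← hc2, hc, mul_div_assoc', Finset.mul_sum]
    congr 1
    exact Finset.sum_congr rfl fun k _ => hk k
  have h3 := congrArg Complex.re h2
  rw [Complex.ofReal_re, Vsq_cast, Complex.div_ofReal_re, Complex.re_sum] at h3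
  rw [h3]
  congr 1
  refine Finset.sum_congr rfl fun k _ => ?_
  rw [Complex.re_mul_ofReal, add_mul, Complex.add_re]

/-- the `κ`-weighted canonical triple is `J_e`:
`Σ_{x,y} κ(x,y) h(x)h(y)g(y−x) = (1/V)Σ_k {Re[conj φ̂(k) φ̂(k+K₁)](F₂(k)+F₂(k+K₁)) + |φ̂(k)|² F₂(k+K₁)}`. [folklore] -/
theorem Q_fourier {f : Tor L → ℝ} (hev : ∀ r : Tor L, f (-r) = f r) (e : Tor L) :
    ∑ x : Tor L, ∑ y : Tor L, kapV L (x, y) * (f x * Dgrad L f e x) * (f y * Dgrad L f e y) * f (y - x) ^ 2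
      = (∑ k : Tor L, (((starRingEnd ℂ) (phiHat L f e k) * phiHat L f e (k + K1 L)).re * (F2 L f k + F2 L f (k + K1 L))
          + Complex.normSq (phiHat L f e k) * F2 L f (k + K1 L))) / (L : ℝ) ^ 2 := by
  have hgev : ∀ r : Tor L, f (-r) ^ 2 = f r ^ 2 := by intro r; rw [hev]
  -- Q = P1 + P2 + P3 with P2 = P1
  simp only [kapV_eq]
  have split : ∀ x y : Tor L,
      ((phase L (K1 L) x).re + (phase L (K1 L) y).re + (phase L (K1 L) (y - x)).re)
        * (f x * Dgrad L f e x) * (f y * Dgrad L f e y) * f (y - x) ^ 2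
      = ((phase L (K1 L) x).re * (f x * Dgrad L f e x)) * (f y * Dgrad L f e y) * f (y - x) ^ 2
        + ((phase L (K1 L) y).re * (f y * Dgrad L f e y)) * (f x * Dgrad L f e x) * f (y - x) ^ 2
        + (f x * Dgrad L f e x) * (f y * Dgrad L f e y) * ((phase L (K1 L) (y - x)).re * f (y - x) ^ 2) := by
    intro x y; ring
  simp_rw [split, Finset.sum_add_distrib]
  have hP2 : ∑ x : Tor L, ∑ y : Tor L, ((phase L (K1 L) y).re * (f y * Dgrad L f e y)) * (f x * Dgrad L f e x) * f (y - x) ^ 2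
      = ∑ x : Tor L, ∑ y : Tor L, ((phase L (K1 L) x).re * (f x * Dgrad L f e x)) * (f y * Dgrad L f e y) * f (y - x) ^ 2 := by
    rw [reindex_swap]
    refine Finset.sum_congr rfl fun x _ => Finset.sum_congr rfl fun y _ => ?_
    rw [show x - y = -(y - x) by abel, hgev]
  rw [hP2, ← two_mul, P1_real L hev e, P3_real L hev e, ← add_div]
  congr 1
  rw [← Finset.sum_add_distrib]
  -- collect: shift `k ↦ k + K₁` in the first modulated piece, swap conjugates in the second
  have hshift : ∑ k : Tor L, ((starRingEnd ℂ) (phiHat L f e (k - K1 L)) * phiHat L f e k).re * F2 L f k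
      = ∑ k : Tor L, ((starRingEnd ℂ) (phiHat L f e k) * phiHat L f e (k + K1 L)).re * F2 L f (k + K1 L) := by
    rw [← Equiv.sum_comp (Equiv.addRight (K1 L))
      (fun k => ((starRingEnd ℂ) (phiHat L f e (k - K1 L)) * phiHat L f e k).re * F2 L f k)]
    refine Finset.sum_congr rfl fun k _ => ?_
    simp only [Equiv.coe_addRight, add_sub_cancel_right]
  have e1 : ∑ k : Tor L, ((((starRingEnd ℂ) (phiHat L f e (k - K1 L)) * phiHat L f e k).re
        + ((starRingEnd ℂ) (phiHat L f e (k + K1 L)) * phiHat L f e k).re) * F2 L f k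
        + Complex.normSq (phiHat L f e k) * F2 L f (k + K1 L))
      = ∑ k : Tor L, ((starRingEnd ℂ) (phiHat L f e (k - K1 L)) * phiHat L f e k).re * F2 L f k
        + ∑ k : Tor L, (((starRingEnd ℂ) (phiHat L f e k) * phiHat L f e (k + K1 L)).re * F2 L f k
            + Complex.normSq (phiHat L f e k) * F2 L f (k + K1 L)) := by
    rw [← Finset.sum_add_distrib]
    refine Finset.sum_congr rfl fun k _ => ?_
    rw [re_conj_mul_comm (phiHat L f e (k + K1 L))]
    ring
  rw [e1, hshift, ← Finset.sum_add_distrib, ← Finset.sum_add_distrib]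
  refine Finset.sum_congr rfl fun k _ => ?_
  ring

/-- ★ **`BCOneLoop L Δ` holds:** `B_C = −3 Σ_e J_e`. [folklore] -/
theorem bcOneLoop_holds (Δ : ℝ) : BCOneLoop L Δ := by
  intro lam2 f hf hev
  have key : ∀ e : Tor L, ∑ c : Cfg L, kapV L c * piR L f c * crossT L f e c
      = 3 * ((∑ k : Tor L, (((starRingEnd ℂ) (phiHat L f e k) * phiHat L f e (k + K1 L)).re
          * (F2 L f k + F2 L f (k + K1 L)) + Complex.normSq (phiHat L f e k) * F2 L f (k + K1 L))) / (L : ℝ) ^ 2) := by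
    intro e
    rw [← Q_fourier L hev e, ← cross_sum_w L (fun a b => kapV L (a, b)) (kapV_diff L) (kapV_neg_shift L) hev e]
  unfold BCterm
  have hE : ∀ c : Cfg L, kapV L c * piR L f c * C0fn L Δ lam2 f c
      = -(1 / 2) * (kapV L c * piR L f c * ((nnList L).map (fun e => crossT L f e c)).sum) := by
    intro c; rw [mul_assoc, piR_mul_C0fn L hf c]; ring
  rw [Finset.sum_congr rfl (fun c _ => hE c)]
  simp_rw [nnList_map_sum]
  have hs : ∑ c : Cfg L, -(1 / 2) * (kapV L c * piR L f c * (crossT L f (ex L) c + crossT L f (-ex L) c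
      + crossT L f (ey L) c + crossT L f (-ey L) c))
      = -(1 / 2) * (∑ c : Cfg L, kapV L c * piR L f c * crossT L f (ex L) c
          + ∑ c : Cfg L, kapV L c * piR L f c * crossT L f (-ex L) c
          + ∑ c : Cfg L, kapV L c * piR L f c * crossT L f (ey L) c
          + ∑ c : Cfg L, kapV L c * piR L f c * crossT L f (-ey L) c) := by
    rw [← Finset.sum_add_distrib, ← Finset.sum_add_distrib, ← Finset.sum_add_distrib, ← Finset.mul_sum]
    congr 1
    refine Finset.sum_congr rfl fun c _ => ?_
    ring
  rw [hs, key, key, key, key]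
  ring

end Summit.HubbardSuperconductivity.HubbardSuperconductivity.Theorems.AnisotropyChord.Transfer.Fibre3

end
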